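import Summits.BirchSwinnertonDyer.BirchSwinnertonDyer.Theorems.KimAtThreeFineKatoKPortJunctionLog
import Literature.NumberTheory.AdelicBaseChange.CyclotomicCompletionTowerProofs
import HarnessLib

/-!
# K-PORT junction (J4d): the log-currency junction ALONG A TOWER `F_u → L_w` — kport's WILD log-lattice
# `ι(Λ₀ᵘ) = {ι (Λ̃ P) : P ∈ E₀(K_u)}` consists of values of `padicLogPointFiniteExt ν (W.baseChange L_w) p` on
# points of `W ⊗ L_w`, for every compatible `ν`; plus the level-carrying form of the tame junction (J4c)
# (cell `bsd-addord`, seat w2-kport gen 3; `--supports stmt-BirchSwinnertonDyer-19560`, helper)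

HONEST FRAMING. Route W2 (`route-BirchSwinnertonDyer-KimAtThreeKolyvagin`), crux 19560
`KatoKuriharaPortThreeShared`, registered line `perFactorKato` (stub hKloc, kim3 LEAD). w2-acc4's
`KimAtThreeFineKatoHLog.perFactorLog_of_dualInt : hDualTame → hDualWild → hLog₀` (p511995) leaves two
displayed duality hypotheses; both are clause (e) for an explicit log-lattice. At a WILD level
(`3 ∣ cycLevel`, place `w₀` of `L = ℚ(ζ_{3m′})` with `e(w₀∣3) = 2`) the lattice is pushed from the unramified
subfield: `Λ₀ := ι '' {Kw.toCompletion 3 F u (Λ̃ P) : P ∈ E₀(Kw 3 F u)}`, `F ⊆ L` a subfield, `u = w₀ ∩ 𝓞 F`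
with `e(u∣3) = 1`, and `ι = Extension.adicCompletionSemialgHom F L ⟨w₀.1, hwu⟩ : F_u → L_{w₀}` the packet's
map (w2-acc4's `hDualWild`, road (R-b)). The Galois-side input (S5b-tower,
`PAdicHodge.exists_smul_range_expStarCoord_tower_iff_trace_log`, w2-c3 p511026) speaks
`padicLogPointFiniteExt ν (W.baseChange L_{w₀}) 3 P′` over ALL points `P′` of `W ⊗ L_{w₀}`. THIS FILE is the
E-side junction between the two (w2-acc4's split 2026-08-27, item (3), wild half):

* §1 plumbing on `L_w` for a compatible `ν`: `valued_natCast_prime_lt_one` (`v_w(p) < 1`),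
  `val_natCast_prime_lt_one_of_compatible`, rfl-bridges `level_comap_toCompletion` /
  `limitLog_comap_toCompletion` (reading the Literature objects on the synonym `K_w`),
  `limitLog_spec_iff_of_isEquiv` (the (SPEC) property is invariant under equivalent valuations) and
  **`limitLog_spec_of_compatible`**: `limitLog ν V p` HAS (SPEC) on `E⁽ᵖ⁾` for every compatible `ν` and every
  `ν`-integral equation `V/L_w` (completeness of `K_w`, `limitLog_spec_of_completeSpace`, moved along (J4b)) —
  the `hℓ` hypothesis of every theorem of `PadicLogFiniteExtension` at `L_w`.
* §2 the tame junction WITH LEVEL DATA: `exists_point_padicLogPointFiniteExt_eq_satLog_of_mem_satKernel` — for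
  `P ∈ Ẽ₁(K_w)` the point `P′` of (J4c) moreover has a positive multiple in the level `E⁽ᵖ⁾` of `W ⊗ L_w` for `ν`
  (so `padicLogPointFiniteExt_add/_map/_map_of_val_eq/_eq_zero_iff` apply to it).
* §3 the tower: `compatible_comap_adicCompletionSemialgHom` (`ν ∘ ι` is compatible on `F_u`:
  `v_w ∘ ι = v_u^{e(w∣u)}`, packet), **`exists_point_padicLogPointFiniteExt_eq_adicCompletionSemialgHom_satLog`**:
  for `P ∈ Ẽ₁(Kw p F u)` (⊇ `E₀` at additive reduction) there is `P′ : (W.baseChange L_w).Point` with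
  `padicLogPointFiniteExt ν (W.baseChange L_w) p P′ = ι (Kw.toCompletion p F u (Λ̃ P))` — (J4c)/§2 at `(F, u)` for
  `ν ∘ ι`, then the Literature base change `padicLogPointFiniteExt_map_of_val_eq` along `ι` (isometric for the pair
  `(ν ∘ ι, ν)` by construction; (SPEC) on both sides by §1); set form
  **`image_clause_d_set_subset_range_padicLogPointFiniteExt`** (`ι '' Λ₀ᵘ ⊆ log_ω^{ν}(E(L_w))` for `W`
  with `Addv W p`) and `forall_image_clause_d_set_of_forall_point` (any property of all `log_ω^{ν}(P′)` holds on
  `ι '' Λ₀ᵘ` — the shape of `hDualWild`).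

TOOL theorems only (no definition, no named fact, no `sorry`, no instance); closes nothing by itself;
nothing booked; BSD / 19560 are not proved by any of this (DUALINT / the unit step and (S5b-tower)'s
instantiation are w2-acc4's / w2-c3's).

References: J. H. Silverman, *The Arithmetic of Elliptic Curves*, 2nd ed. (2009), IV.6.4, VII.2
[SilvermanAEC2009]; J. W. S. Cassels, A. Fröhlich, *Algebraic Number Theory* (1967), Ch. II §10
[CasselsFrohlichANT1967]; J.-P. Serre, *Local Fields* (1979), Ch. II §1–§3 [SerreLocalFields1979].
-/

noncomputable section

-- the cell's Theorems namespace `Summit.BirchSwinnertonDyer.BirchSwinnertonDyer.…` repeats the summit name by design (D-0017)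
set_option linter.dupNamespace false

open scoped NNReal NumberField Classical
open IsDedekindDomain NumberField

namespace Summit.BirchSwinnertonDyer.BirchSwinnertonDyer.Theorems.KPort

open Summit.BirchSwinnertonDyer.Rank1Residual.Additive Summit.BirchSwinnertonDyer.Rank1Residual.Additive.BallEval
open Summit.BirchSwinnertonDyer.Rank1Residual.Additive.LocalLog Literature.NumberTheory.EllipticCurves.Rank1Residual
open Literature.NumberTheory.GaloisRepresentations.LubinTate (unitBall mem_unitBall_iff)
open Literature.NumberTheory.EllipticCurves Literature.NumberTheory.EllipticCurves.FormalGroupChart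
open Literature.NumberTheory.GaloisRepresentations Literature.NumberTheory.AdelicBaseChange
open WeierstrassCurve

namespace Kw

variable {p : ℕ} [hp : Fact p.Prime] {L : Type} [Field L] [NumberField L]
  (w : ((Rat.HeightOneSpectrum.primesEquiv (R := 𝓞 ℚ)).symm ⟨p, hp.out⟩).Extension (𝓞 L))

/-! ## §1 Plumbing on `L_w`: `v_w(p) < 1`, the Literature objects read on `K_w`, (SPEC) for compatible `ν` -/

/-- `v_w(p) < 1` in `L_w` for a place `w ∣ p` (`p ∈ w`). [folklore] -/
theorem valued_natCast_prime_lt_one :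
    Valued.v ((p : ℕ) : w.1.adicCompletion L) < (1 : WithZero (Multiplicative ℤ)) := by
  have h1 : ((p : ℕ) : w.1.adicCompletion L) = ((algebraMap (𝓞 L) L p : L) : w.1.adicCompletion L) := by
    rw [← map_natCast (algebraMap (𝓞 L) (w.1.adicCompletion L)) p]
    rfl
  rw [h1, HeightOneSpectrum.adicCompletion.valued_coe]
  exact (w.1.valuation_lt_one_iff_mem (p : 𝓞 L)).2 (prime_mem_asIdeal w)

/-- `ν(p) < 1` for every valuation `ν` of `L_w` compatible with its valuative relation. [folklore] -/
theorem val_natCast_prime_lt_one_of_compatible (ν : Valuation (w.1.adicCompletion L) ℝ≥0) [ν.Compatible] :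
    ν ((p : ℕ) : w.1.adicCompletion L) < 1 :=
  (ValuativeRel.isEquiv ν (Valued.v : Valuation (w.1.adicCompletion L) (WithZero (Multiplicative ℤ)))).lt_one_iff_lt_one.mpr
    (valued_natCast_prime_lt_one w)

/-- `(p : L_w) ≠ 0`. [folklore] -/
theorem natCast_prime_ne_zero_completion : ((p : ℕ) : w.1.adicCompletion L) ≠ 0 := by
  haveI := LocalField.charZero_adicCompletion w.1
  exact Nat.cast_ne_zero.mpr hp.out.ne_zero

/-- `‖p‖ < 1` in the base-`p` norm of `K_w` (any ramification). [folklore] -/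
theorem valuation_natCast_prime_lt_one_Kw :
    NormedField.valuation ((p : ℕ) : Kw p L w) < 1 := by
  rw [(valuation_isEquiv_valued (p := p) (L := L) (w := w)).lt_one_iff_lt_one]
  exact valued_natCast_prime_lt_one w

/-- Reading the level on `K_w`: for `ν` read on the synonym (`ν.comap Kw.toCompletion`) the level `E⁽ᶜ⁾` of an
equation `V/L_w` is the same subgroup (definitionally). [folklore] -/
theorem level_comap_toCompletion (ν : Valuation (w.1.adicCompletion L) ℝ≥0)
    (V : WeierstrassCurve (w.1.adicCompletion L)) [hV : V.IsIntegral ν.integer] (c : ℝ≥0) :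
    @level (Kw p L w) (Kw.instField p L w) (ν.comap (toCompletion p L w).toRingHom) V
        (isIntegral_comap_toCompletion (p := p) w ν V) c = level ν V c :=
  rfl

/-- Reading the limit logarithm on `K_w` (definitionally the same function). [folklore] -/
theorem limitLog_comap_toCompletion (ν : Valuation (w.1.adicCompletion L) ℝ≥0)
    (V : WeierstrassCurve (w.1.adicCompletion L)) (q : ℕ) :
    @limitLog (Kw p L w) (Kw.instField p L w) (ν.comap (toCompletion p L w).toRingHom) V q = limitLog ν V q :=
  rfl

omit hp in
/-- **(SPEC) is invariant under equivalent valuations** (same level, same `limitLog`, same inequalities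
`|x| ≤ |p^{r+1}|`). [cite: SilvermanAEC2009, Thm. IV.6.4 with Prop. VII.2.2] -/
theorem limitLog_spec_iff_of_isEquiv {K : Type*} [Field K] {w₁ w₂ : Valuation K ℝ≥0} (h : w₁.IsEquiv w₂)
    {V : WeierstrassCurve K} [V.IsIntegral w₁.integer] [V.IsIntegral w₂.integer] (q : ℕ) :
    (∀ Q ∈ level w₁ V (w₁ (q : K)), ∀ r : ℕ,
        w₁ (limitLog w₁ V q Q - ((q ^ r) • Q).zCoord / (q : K) ^ r) ≤ w₁ (q : K) ^ (r + 1)) ↔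
      ∀ Q ∈ level w₂ V (w₂ (q : K)), ∀ r : ℕ,
        w₂ (limitLog w₂ V q Q - ((q ^ r) • Q).zCoord / (q : K) ^ r) ≤ w₂ (q : K) ^ (r + 1) := by
  rw [level_eq_of_isEquiv h (q : K), limitLog_eq_of_isEquiv h q]
  refine forall₂_congr fun Q _ => forall_congr' fun r => ?_
  rw [← map_pow, ← map_pow, h.le_iff_le]

/-- **`limitLog ν V p` has (SPEC) on the level `E⁽ᵖ⁾` for every compatible `ν` and every `ν`-integral equation
`V/L_w`** — the hypothesis `hℓ` of the `PadicLogFiniteExtension` API at `L_w` (completeness of `K_w`: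
`limitLog_spec_of_completeSpace` on the synonym, transported along (J4b)). [cite: SilvermanAEC2009, Thm. IV.6.4 with Prop. VII.2.2] -/
theorem limitLog_spec_of_compatible (ν : Valuation (w.1.adicCompletion L) ℝ≥0) [ν.Compatible]
    (V : WeierstrassCurve (w.1.adicCompletion L)) [hV : V.IsIntegral ν.integer] :
    ∀ Q ∈ level ν V (ν ((p : ℕ) : w.1.adicCompletion L)), ∀ r : ℕ,
      ν (limitLog ν V p Q - ((p ^ r) • Q).zCoord / ((p : ℕ) : w.1.adicCompletion L) ^ r) ≤
        ν ((p : ℕ) : w.1.adicCompletion L) ^ (r + 1) := by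
  have hequiv := valuation_isEquiv_of_compatible (p := p) w ν
  haveI hV₁ := isIntegral_comap_toCompletion (p := p) w ν V
  haveI hV₀ : @WeierstrassCurve.IsIntegral (NormedField.valuation (K := Kw p L w)).integer _ (Kw p L w) _ _ V :=
    isIntegral_of_isEquiv hequiv.symm _
  have h0 := limitLog_spec_of_completeSpace (K := Kw p L w) (V := V) (p := p)
    (by exact natCast_prime_ne_zero_completion (p := p) w) (valuation_natCast_prime_lt_one_Kw (p := p) w)
  have h1 := (limitLog_spec_iff_of_isEquiv hequiv p).mp h0
  exact h1

/-! ## §2 The tame junction with level data -/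

omit hp in
/-- Transport of a point along an equality of models, keeping its logarithm AND its level memberships
(`subst`). [folklore] -/
theorem exists_point_eq_of_eq_with_level {K : Type*} [Field K] (ν : Valuation K ℝ≥0)
    {V V' : WeierstrassCurve K} (hVV' : V = V') [V.IsIntegral ν.integer] [V'.IsIntegral ν.integer] (q : ℕ)
    (P : V.toAffine.Point) :
    ∃ P' : V'.toAffine.Point, padicLogPointFiniteExt ν V' q P' = padicLogPointFiniteExt ν V q P ∧
      ∀ (m : ℕ) (c : ℝ≥0), m • P' ∈ level ν V' c ↔ m • P ∈ level ν V c := by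
  subst hVV'
  exact ⟨P, rfl, fun _ _ => Iff.rfl⟩

section Tame

variable [he : Fact (w.1.asIdeal.ramificationIdx (𝓞 ℚ) = 1)] (W : WeierstrassCurve ℚ) [W.IsGloballyMinimal]
  [hE : (((integralModelInt W).map (Int.castRingHom ℤ_[p])).map PadicInt.Coe.ringHom).IsElliptic]
  [hint : (curveK p (Kw p L w) ((integralModelInt W).map (Int.castRingHom ℤ_[p]))).IsIntegral
    (NormedField.valuation (K := Kw p L w)).integer]
  (ν : Valuation (w.1.adicCompletion L) ℝ≥0) [ν.Compatible]
  [hν : (W.baseChange (w.1.adicCompletion L)).IsIntegral ν.integer]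

/-- **The tame junction with level data**: for `P ∈ Ẽ₁(K_w)` (some positive multiple in `E₁`; all of
`E₀(K_w)` at additive reduction) the point `P′` of `W ⊗ L_w` with `log_ω^{ν}(P′) = Kw.toCompletion (Λ̃ P)`
can be taken with a positive multiple in the level `E⁽ᵖ⁾` of `W ⊗ L_w` for `ν`.
[cite: SilvermanAEC2009, Thm. IV.6.4 with Prop. VII.2.2] -/
theorem exists_point_padicLogPointFiniteExt_eq_satLog_of_mem_satKernel
    {P : (curveK p (Kw p L w) ((integralModelInt W).map (Int.castRingHom ℤ_[p]))).toAffine.Point}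
    (hP : P ∈ satKernel p (Kw p L w) ((integralModelInt W).map (Int.castRingHom ℤ_[p]))) :
    ∃ P' : (W.baseChange (w.1.adicCompletion L)).toAffine.Point,
      padicLogPointFiniteExt ν (W.baseChange (w.1.adicCompletion L)) p P' =
          toCompletion p L w (satLog p (Kw p L w) ((integralModelInt W).map (Int.castRingHom ℤ_[p])) P) ∧
        ∃ m : ℕ, 0 < m ∧ m • P' ∈ level ν (W.baseChange (w.1.adicCompletion L))
          (ν ((p : ℕ) : w.1.adicCompletion L)) := by
  have hC := curveK_integralModelInt_eq_baseChange (p := p) w W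
  have hequiv := valuation_isEquiv_of_compatible (p := p) w ν
  haveI hν₁ : (curveK p (Kw p L w) ((integralModelInt W).map (Int.castRingHom ℤ_[p]))).IsIntegral
      (ν.comap (toCompletion p L w).toRingHom).integer :=
    isIntegral_of_isEquiv hequiv _
  haveI hν₂ := isIntegral_comap_toCompletion (p := p) w ν (W.baseChange (w.1.adicCompletion L))
  obtain ⟨m, hm, hmP⟩ := exists_nsmul_mem_level_of_mem_satKernel hP
  obtain ⟨P', hP', hlev⟩ :=
    exists_point_eq_of_eq_with_level (ν.comap (toCompletion p L w).toRingHom) hC p P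
  refine ⟨P', ?_, m, hm, ?_⟩
  · rw [← padicLogPointFiniteExt_comap_toCompletion (p := p) w ν (W.baseChange (w.1.adicCompletion L)) p P', hP',
      toCompletion_apply, satLog_eq_padicLogPointFiniteExt, padicLogPointFiniteExt_apply_eq_of_isEquiv hequiv p P]
  · rw [← level_comap_toCompletion (p := p) w ν (W.baseChange (w.1.adicCompletion L))]
    rw [level_eq_of_isEquiv hequiv ((p : ℕ) : Kw p L w)] at hmP
    exact (hlev m _).mpr hmP

end Tame

/-! ## §3 The tower `F_u → L_w`: the wild log-lattice `ι(Λ₀ᵘ)` lies in `log_ω^{ν}(E(L_w))` -/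

section Tower

variable {F : Type} [Field F] [NumberField F] [Algebra F L]
  (u : ((Rat.HeightOneSpectrum.primesEquiv (R := 𝓞 ℚ)).symm ⟨p, hp.out⟩).Extension (𝓞 F))
  (h : w.1.under (𝓞 F) = u.1)

/-- **`ν ∘ ι` is compatible with the valuative relation of `F_u`** for `ι : F_u → L_w` the packet map of the
tower and `ν` compatible on `L_w` (`v_w(ι x) = v_u(x)^{e(w∣u)}`, `e ≠ 0`, so `ι` preserves and reflects the
order of values). [cite: CasselsFrohlichANT1967, Ch. II §10] -/
theorem compatible_comap_adicCompletionSemialgHom (ν : Valuation (w.1.adicCompletion L) ℝ≥0) [ν.Compatible] :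
    (ν.comap (HeightOneSpectrum.Extension.adicCompletionSemialgHom F L
      (⟨w.1, h⟩ : u.1.Extension (𝓞 L))).toRingHom).Compatible := by
  have hne : w.1.asIdeal.ramificationIdx (𝓞 F) ≠ 0 :=
    HeightOneSpectrum.ramificationIdx_ne_zero (𝓞 F) (𝓞 L)
      (algebraMap_injective_of_field_isFractionRing (𝓞 F) (𝓞 L) F L) w.1
  have hL := ValuativeRel.isEquiv ν (Valued.v : Valuation (w.1.adicCompletion L) (WithZero (Multiplicative ℤ)))
  refine ⟨fun x y => ?_⟩
  have e1 := HeightOneSpectrum.Extension.valued_adicCompletionSemialgHom F L (⟨w.1, h⟩ : u.1.Extension (𝓞 L)) x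
  have e2 := HeightOneSpectrum.Extension.valued_adicCompletionSemialgHom F L (⟨w.1, h⟩ : u.1.Extension (𝓞 L)) y
  rw [Valuation.Compatible.vle_iff_le (v := (Valued.v : Valuation (u.1.adicCompletion F) (WithZero (Multiplicative ℤ)))),
    Valuation.comap_apply, Valuation.comap_apply, SemialgHom.toRingHom_eq_coe, RingHom.coe_coe, hL.le_iff_le]
  simp only [e1, e2]
  exact (pow_le_pow_iff_left₀ zero_le zero_le hne).symm

variable [hu : Fact (u.1.asIdeal.ramificationIdx (𝓞 ℚ) = 1)] (W : WeierstrassCurve ℚ) [W.IsGloballyMinimal]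
  [hE : (((integralModelInt W).map (Int.castRingHom ℤ_[p])).map PadicInt.Coe.ringHom).IsElliptic]
  [hint : (curveK p (Kw p F u) ((integralModelInt W).map (Int.castRingHom ℤ_[p]))).IsIntegral
    (NormedField.valuation (K := Kw p F u)).integer]
  (ν : Valuation (w.1.adicCompletion L) ℝ≥0) [ν.Compatible]
  [hν : (W.baseChange (w.1.adicCompletion L)).IsIntegral ν.integer]

/-- **The wild junction**: for `P ∈ Ẽ₁(Kw p F u)` there is a point `P′` of `W ⊗ L_w` with
`padicLogPointFiniteExt ν (W.baseChange L_w) p P′ = ι (Kw.toCompletion p F u (Λ̃ P))`, `ι : F_u → L_w` the packet's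
tower map — (J4c)/§2 at `(F, u)` for `ν ∘ ι`, then `padicLogPointFiniteExt_map_of_val_eq` along `ι`
(`P′ = ι_* P′_F`). [cite: SilvermanAEC2009, Thm. IV.6.4 with Prop. VII.2.2] -/
theorem exists_point_padicLogPointFiniteExt_eq_adicCompletionSemialgHom_satLog
    {P : (curveK p (Kw p F u) ((integralModelInt W).map (Int.castRingHom ℤ_[p]))).toAffine.Point}
    (hP : P ∈ satKernel p (Kw p F u) ((integralModelInt W).map (Int.castRingHom ℤ_[p]))) :
    ∃ P' : (W.baseChange (w.1.adicCompletion L)).toAffine.Point,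
      padicLogPointFiniteExt ν (W.baseChange (w.1.adicCompletion L)) p P' =
        HeightOneSpectrum.Extension.adicCompletionSemialgHom F L (⟨w.1, h⟩ : u.1.Extension (𝓞 L))
          (toCompletion p F u (satLog p (Kw p F u) ((integralModelInt W).map (Int.castRingHom ℤ_[p])) P)) := by
  set ι := HeightOneSpectrum.Extension.adicCompletionSemialgHom F L (⟨w.1, h⟩ : u.1.Extension (𝓞 L)) with hι
  let νF : Valuation (u.1.adicCompletion F) ℝ≥0 := ν.comap ι.toRingHom
  haveI : νF.Compatible := compatible_comap_adicCompletionSemialgHom (p := p) w u h ν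
  haveI hνF : (W.baseChange (u.1.adicCompletion F)).IsIntegral νF.integer :=
    isIntegral_baseChange_completion u νF W
  -- the tame junction at `(F, u)` for `ν ∘ ι`, with level data
  obtain ⟨P₁, hlog₁, m, hm, hmP₁⟩ :=
    exists_point_padicLogPointFiniteExt_eq_satLog_of_mem_satKernel (p := p) u W νF hP
  -- `ι` as a `ℚ`-algebra map and the base change of `log_ω` along it
  let ιℚ : u.1.adicCompletion F →ₐ[ℚ] w.1.adicCompletion L := ι.toRingHom.toRatAlgHom
  refine ⟨WeierstrassCurve.Affine.Point.map ιℚ P₁, ?_⟩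
  have hval : ∀ x, ν (ιℚ x) = νF x := fun x => rfl
  rw [padicLogPointFiniteExt_map_of_val_eq (X := W) (natCast_prime_ne_zero_completion (p := p) u)
      (val_natCast_prime_lt_one_of_compatible (p := p) u νF) (limitLog_spec_of_compatible (p := p) u νF _)
      (limitLog_spec_of_compatible (p := p) w ν _) hval hm hmP₁, hlog₁]
  rfl

/-- **`ι(Λ₀ᵘ) ⊆ log_ω^{ν}(E(L_w))`** for `W/ℚ` globally minimal with `Addv W p`: the push along `ι` of kport's
log-lattice over the unramified subfield — w2-acc4's wild `Λ₀` of `hDualWild` — is contained in the set of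
values of `padicLogPointFiniteExt ν (W.baseChange L_w) p` on the points of `W ⊗ L_w` (`E₀ ⊆ Ẽ₁` at additive
reduction). [cite: SilvermanAEC2009, Thm. IV.6.4 with Prop. VII.2.1–2.2] -/
theorem image_clause_d_set_subset_range_padicLogPointFiniteExt [W.IsElliptic] (hadd : Addv W p) :
    HeightOneSpectrum.Extension.adicCompletionSemialgHom F L (⟨w.1, h⟩ : u.1.Extension (𝓞 L)) ''
        {x : u.1.adicCompletion F | ∃ P ∈ (((integralModelInt W).map (Int.castRingHom ℤ_[p])).map
          (coeffHom p (Kw p F u))).nonsingularReductionSubgroup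
          (Valuation.integer.integers (NormedField.valuation (K := Kw p F u))),
        toCompletion p F u (satLog p (Kw p F u) ((integralModelInt W).map (Int.castRingHom ℤ_[p])) P) = x} ⊆
      {x : w.1.adicCompletion L | ∃ P' : (W.baseChange (w.1.adicCompletion L)).toAffine.Point,
        padicLogPointFiniteExt ν (W.baseChange (w.1.adicCompletion L)) p P' = x} := by
  rintro _ ⟨x, ⟨P, hP, rfl⟩, rfl⟩
  exact exists_point_padicLogPointFiniteExt_eq_adicCompletionSemialgHom_satLog (p := p) w u h W ν
    (nonsingularReductionSubgroup_le_satKernel_of_addv W hadd hP)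

/-- **`hDualWild` reduction**: any property `Φ` holding for `log_ω^{ν}(P′)` at EVERY point `P′` of `W ⊗ L_w`
holds for `ι (Kw.toCompletion p F u (Λ̃ P))` for every `P ∈ E₀(Kw p F u)` (`Addv W p`).
[cite: SilvermanAEC2009, Thm. IV.6.4 with Prop. VII.2.1–2.2] -/
theorem forall_image_clause_d_set_of_forall_point [W.IsElliptic] (hadd : Addv W p) (Φ : w.1.adicCompletion L → Prop)
    (hΦ : ∀ P' : (W.baseChange (w.1.adicCompletion L)).toAffine.Point,
      Φ (padicLogPointFiniteExt ν (W.baseChange (w.1.adicCompletion L)) p P'))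
    {P : (curveK p (Kw p F u) ((integralModelInt W).map (Int.castRingHom ℤ_[p]))).toAffine.Point}
    (hP : P ∈ (((integralModelInt W).map (Int.castRingHom ℤ_[p])).map (coeffHom p (Kw p F u))).nonsingularReductionSubgroup
      (Valuation.integer.integers (NormedField.valuation (K := Kw p F u)))) :
    Φ (HeightOneSpectrum.Extension.adicCompletionSemialgHom F L (⟨w.1, h⟩ : u.1.Extension (𝓞 L))
      (toCompletion p F u (satLog p (Kw p F u) ((integralModelInt W).map (Int.castRingHom ℤ_[p])) P))) := by
  obtain ⟨P', hP'⟩ := exists_point_padicLogPointFiniteExt_eq_adicCompletionSemialgHom_satLog (p := p) w u h W ν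
    (nonsingularReductionSubgroup_le_satKernel_of_addv W hadd hP)
  rw [← hP']
  exact hΦ P'

end Tower

end Kw

end Summit.BirchSwinnertonDyer.BirchSwinnertonDyer.Theorems.KPort

end
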